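import Summits.Ventures.WeilGRH.UniformConductorFloorCells
import HarnessLib

/-!
# GRH arm (rh-explicit, venture WeilGRH): the uniform conductor floor with a cell certificate — all shifts

Cell `rh-explicit`, WEIL TRACK — GRH ARM (weil-grh-1).  Second half of `UniformConductorFloorCells.lean`
(see its module docstring): the one-shift inequality `UniformFloor.two_mul_integral_le_of_phi` summed over
the prime powers `n ≤ N` with weights `w̄_n ≥ Λ(n)/√n` and compared pointwise with the certificate constant:

* `UniformFloor.sum_two_mul_norm_weilConv_le_of_cert`: if `Σ_n w̄_n [max(φ_{j−s_n−1}, φ_{j−s_n}) +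
  max(φ_{j+s_n}, φ_{j+s_n+1})] ≤ ρ φ_j` for `0 ≤ j < J` then `Σ_n (Λ(n)/√n)·2|k(log n)| ≤ ρ‖g‖₂²`
  (`k = g ⋆ g̃`, `g` supported in `[-t, t]`) — a Collatz–Wielandt bound for the positivity-preserving
  translation pattern `S⁺_t = Σ_n (Λ(n)/√n)(τ_{log n} + τ_{−log n})` on `L²[-t, t]`;
* `UniformFloor.weilPositivityOnChar_of_phi_budget`: for `χ` mod `q ≠ 1` of parity `κ`, `x = ¼ + κ/2`,
  `log π − ψ(x) − Σ_{m<M}(1/(m+x) − 2t) + ρ ≤ log q ⇒ WeilPositivityOnChar χ t` — uniform in the values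
  of `χ`, no `ζ` input.

Certificates: `UniformConductorFloorCellsRungs.lean`.

## References

* A. Weil (1952), (11) and the «lemme» p. 262 [Weil1952FormulesExplicites]; H. Yoshida (1992) §2, §6 [Yoshida1992].
-/

noncomputable section

open Complex Filter Set MeasureTheory
open scoped Real Topology ComplexConjugate ArithmeticFunction.vonMangoldt

namespace Summit.Ventures.WeilGRH

open Literature.NumberTheory.LFunctions

namespace UniformFloor

variable {g : ℝ → ℂ}

/-! ## All shifts: the `φ`-certificate and the floor theorem -/

/-- **CELL CERTIFICATE ⇒ JOINT PRIME BUDGET.**  With `δ = 2t/J`, shift indices `s_n` (`s_nδ ≤ log n ≤ (s_n+1)δ`),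
weights `w̄_n ≥ Λ(n)/√n` and a vector `φ` as in `two_mul_integral_le_of_phi`: if for every `0 ≤ j < J`
`Σ_{n≤N} w̄_n [max(φ_{j−s_n−1}, φ_{j−s_n}) + max(φ_{j+s_n}, φ_{j+s_n+1})] ≤ ρ φ_j`, then
`Σ_{n≤N} (Λ(n)/√n)·2|k(log n)| ≤ ρ‖g‖₂²` for every test function `g` supported in `[-t, t]`.
[folklore] -/
theorem sum_two_mul_norm_weilConv_le_of_cert (hg : IsWeilTest g) {t : ℝ} (ht : 0 < t)
    (hsupp : tsupport g ⊆ Icc (-t) t) {J : ℕ} (hJ : 0 < J) (φ : ℤ → ℝ) {Φ₀ Φ₁ : ℝ} (hΦ₀ : 0 < Φ₀)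
    (hφlo : ∀ i, 0 ≤ i → i < (J : ℤ) → Φ₀ ≤ φ i) (hφhi : ∀ i, φ i ≤ Φ₁)
    (hφout : ∀ i, i < 0 ∨ (J : ℤ) ≤ i → φ i = 0) (N : ℕ) (s : ℕ → ℕ)
    (hs : ∀ n ∈ Finset.range (N + 1),
      ((s n : ℤ) : ℝ) * (2 * t / J) ≤ Real.log n ∧ Real.log n ≤ (((s n : ℤ) : ℝ) + 1) * (2 * t / J))
    (wbar : ℕ → ℝ) (hw : ∀ n ∈ Finset.range (N + 1), (Λ n : ℝ) / Real.sqrt n ≤ wbar n) {ρ : ℝ}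
    (hcert : ∀ j ∈ Finset.range J,
      ∑ n ∈ Finset.range (N + 1), wbar n *
        (max (φ ((j : ℤ) - s n - 1)) (φ ((j : ℤ) - s n)) + max (φ ((j : ℤ) + s n)) (φ ((j : ℤ) + s n + 1))) ≤
        ρ * φ (j : ℤ)) :
    ∑ n ∈ Finset.range (N + 1), (Λ n : ℝ) / Real.sqrt n * (2 * ‖weilConv g (weilReflect g) (Real.log n)‖) ≤
      ρ * weilNorm2Sq g := by
  set δ : ℝ := 2 * t / J with hδdef
  have hδ : 0 < δ := by positivity
  have hgc : Continuous g := hg.1.continuous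
  have hφ0 : ∀ i, 0 ≤ φ i := by
    intro i
    rcases lt_or_ge i 0 with h | h
    · rw [hφout i (Or.inl h)]
    · rcases lt_or_ge i (J : ℤ) with h' | h'
      · exact hΦ₀.le.trans (hφlo i h h')
      · rw [hφout i (Or.inr h')]
  have hΦ₁ : 0 < Φ₁ := by
    have h0 := hφlo 0 le_rfl (by exact_mod_cast hJ)
    linarith [hφhi 0]
  -- `ρ ≥ 0` from the certificate at `j = 0`
  have hρ : 0 ≤ ρ := by
    have h := hcert 0 (Finset.mem_range.2 hJ)
    simp only [Nat.cast_zero] at h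
    have hφ00 : 0 < φ 0 := hΦ₀.trans_le (hφlo 0 le_rfl (by exact_mod_cast hJ))
    have hw0 : ∀ n ∈ Finset.range (N + 1), 0 ≤ wbar n := fun n hn ↦
      (div_nonneg ArithmeticFunction.vonMangoldt_nonneg (Real.sqrt_nonneg _)).trans (hw n hn)
    have hsum : 0 ≤ ∑ n ∈ Finset.range (N + 1), wbar n *
        (max (φ (0 - s n - 1)) (φ (0 - s n)) + max (φ (0 + s n)) (φ (0 + s n + 1))) :=
      Finset.sum_nonneg fun n hn ↦ mul_nonneg (hw0 n hn)
        (add_nonneg ((hφ0 _).trans (le_max_left _ _)) ((hφ0 _).trans (le_max_left _ _)))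
    nlinarith
  -- the per-shift step weights `V_n(j) = (A_{n,j} + B_{n,j})/φ_j`
  set V : ℕ → ℤ → ℝ := fun n j ↦
    (max (φ (j - s n - 1)) (φ (j - s n)) + max (φ (j + s n)) (φ (j + s n + 1))) / φ j with hV
  have hVbd : ∀ n j, |V n j| ≤ 2 * Φ₁ / Φ₀ := by
    intro n j
    have hnum0 : 0 ≤ max (φ (j - s n - 1)) (φ (j - s n)) + max (φ (j + s n)) (φ (j + s n + 1)) :=
      add_nonneg ((hφ0 _).trans (le_max_left _ _)) ((hφ0 _).trans (le_max_left _ _))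
    have hnum1 : max (φ (j - s n - 1)) (φ (j - s n)) + max (φ (j + s n)) (φ (j + s n + 1)) ≤ 2 * Φ₁ := by
      have := max_le (hφhi (j - s n - 1)) (hφhi (j - s n))
      have := max_le (hφhi (j + s n)) (hφhi (j + s n + 1))
      linarith
    rcases lt_or_ge j 0 with h | h
    · simp only [hV, hφout j (Or.inl h), div_zero, abs_zero]; positivity
    rcases lt_or_ge j (J : ℤ) with h' | h'
    · have hφj : 0 < φ j := hΦ₀.trans_le (hφlo j h h')
      simp only [hV]
      rw [abs_of_nonneg (div_nonneg hnum0 hφj.le), div_le_div_iff₀ hφj hΦ₀]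
      calc _ ≤ 2 * Φ₁ * Φ₀ := mul_le_mul_of_nonneg_right hnum1 hΦ₀.le
        _ ≤ 2 * Φ₁ * φ j := mul_le_mul_of_nonneg_left (hφlo j h h') (by positivity)
    · simp only [hV, hφout j (Or.inr h'), div_zero, abs_zero]; positivity
  have hIV : ∀ n, Integrable fun x : ℝ ↦ V n ⌊(x + t) / δ⌋ * ‖g x‖ ^ 2 := by
    intro n
    simpa only [sub_zero] using integrable_step_mul hg (V n) (hVbd n) t δ 0
  -- per shift
  have hshift : ∀ n ∈ Finset.range (N + 1),
      (Λ n : ℝ) / Real.sqrt n * (2 * ‖weilConv g (weilReflect g) (Real.log n)‖) ≤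
        wbar n * ∫ x : ℝ, V n ⌊(x + t) / δ⌋ * ‖g x‖ ^ 2 := by
    intro n hn
    have hΛ : 0 ≤ (Λ n : ℝ) / Real.sqrt n :=
      div_nonneg ArithmeticFunction.vonMangoldt_nonneg (Real.sqrt_nonneg _)
    have h2 := two_mul_integral_le_of_phi hg ht hsupp hJ φ hΦ₀ hφlo hφhi hφout
      (L := Real.log n) (s := (s n : ℤ)) (by positivity) (hs n hn).1 (hs n hn).2
    have hk := norm_weilConv_weilReflect_le_integral_mul g (Real.log n)
    have hkk : 2 * ‖weilConv g (weilReflect g) (Real.log n)‖ ≤ ∫ x : ℝ, V n ⌊(x + t) / δ⌋ * ‖g x‖ ^ 2 := by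
      refine (by linarith : 2 * ‖weilConv g (weilReflect g) (Real.log n)‖ ≤
        2 * ∫ x : ℝ, ‖g x‖ * ‖g (x - Real.log n)‖).trans ?_
      simpa only [hV, hδdef] using h2
    have h0 : 0 ≤ 2 * ‖weilConv g (weilReflect g) (Real.log n)‖ := by positivity
    calc (Λ n : ℝ) / Real.sqrt n * (2 * ‖weilConv g (weilReflect g) (Real.log n)‖)
        ≤ wbar n * (2 * ‖weilConv g (weilReflect g) (Real.log n)‖) :=
          mul_le_mul_of_nonneg_right (hw n hn) h0
      _ ≤ wbar n * ∫ x : ℝ, V n ⌊(x + t) / δ⌋ * ‖g x‖ ^ 2 :=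
          mul_le_mul_of_nonneg_left hkk (hΛ.trans (hw n hn))
  -- sum and compare pointwise with `ρ`
  have hsum := Finset.sum_le_sum hshift
  have e1 : ∑ n ∈ Finset.range (N + 1), wbar n * ∫ x : ℝ, V n ⌊(x + t) / δ⌋ * ‖g x‖ ^ 2 =
      ∫ x : ℝ, ∑ n ∈ Finset.range (N + 1), wbar n * (V n ⌊(x + t) / δ⌋ * ‖g x‖ ^ 2) := by
    rw [integral_finsetSum _ fun n _ ↦ (hIV n).const_mul (wbar n)]
    refine Finset.sum_congr rfl fun n _ ↦ ?_
    rw [integral_const_mul]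
  have hI : Integrable (fun u : ℝ ↦ ‖g u‖ ^ 2) := by
    refine (hgc.norm.pow 2).integrable_of_hasCompactSupport ?_
    rw [pow_two]
    exact hg.2.norm.mul_right
  have hpt : ∀ x : ℝ, ∑ n ∈ Finset.range (N + 1), wbar n * (V n ⌊(x + t) / δ⌋ * ‖g x‖ ^ 2) ≤
      ρ * ‖g x‖ ^ 2 := by
    intro x
    by_cases hgx : g x = 0
    · simp [hgx]
    have hxI := mem_Ioo_of_ne_zero hg hsupp hgx
    obtain ⟨hj0, hjJ⟩ := floor_mem_range ht hJ hxI
    rw [← hδdef] at hj0 hjJ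
    set j := ⌊(x + t) / δ⌋ with hj
    have hφj : 0 < φ j := hΦ₀.trans_le (hφlo j hj0 hjJ)
    have hc := hcert j.toNat (Finset.mem_range.2 (by omega))
    rw [Int.toNat_of_nonneg hj0] at hc
    have e : ∑ n ∈ Finset.range (N + 1), wbar n * (V n j * ‖g x‖ ^ 2) =
        (∑ n ∈ Finset.range (N + 1), wbar n *
          (max (φ (j - s n - 1)) (φ (j - s n)) + max (φ (j + s n)) (φ (j + s n + 1)))) / φ j *
          ‖g x‖ ^ 2 := by
      rw [Finset.sum_div, Finset.sum_mul]
      refine Finset.sum_congr rfl fun n _ ↦ ?_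
      simp only [hV]
      ring
    rw [e]
    refine mul_le_mul_of_nonneg_right ?_ (by positivity)
    rw [div_le_iff₀ hφj]
    exact hc
  have hfin : ∫ x : ℝ, ∑ n ∈ Finset.range (N + 1), wbar n * (V n ⌊(x + t) / δ⌋ * ‖g x‖ ^ 2) ≤
      ∫ x : ℝ, ρ * ‖g x‖ ^ 2 :=
    integral_mono (integrable_finsetSum _ fun n _ ↦ (hIV n).const_mul (wbar n)) (hI.const_mul ρ) hpt
  rw [integral_const_mul] at hfin
  calc _ ≤ _ := hsum
    _ = _ := e1
    _ ≤ ρ * ∫ x : ℝ, ‖g x‖ ^ 2 := hfin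
    _ = ρ * weilNorm2Sq g := rfl

/-- **UNIFORM CONDUCTOR FLOOR WITH A CELL CERTIFICATE.**  As `weilPositivityOnChar_of_budget`, with the
shift-by-shift prime budget `2Σ_n (Λ(n)/√n)c_n` replaced by a certified joint budget `ρ`
(`sum_two_mul_norm_weilConv_le_of_cert`): for `χ` mod `q ≠ 1` of parity `κ`, `x = 1/4 + κ/2`, `t > 0`,
`e^{2t} ≤ N + 1`, `M ∈ ℕ`, `ψ₀ ≤ ψ(x)` and a `φ`-certificate with constant `ρ` on `J` cells,
`log π − ψ₀ − Σ_{m<M}(1/(m+x) − 2t) + ρ ≤ log q ⇒ WeilPositivityOnChar χ t`.  Uniform in the values of `χ`;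
no `ζ` input. [cite: Weil1952FormulesExplicites, (11) and the «lemme» p. 262; Yoshida1992, §2 (2.1), §6] -/
theorem weilPositivityOnChar_of_phi_budget {q : ℕ} (hq : q ≠ 1) (χ : DirichletCharacter ℂ q) {κ : ℕ}
    (hκ : charParity χ = κ) {t : ℝ} (ht : 0 < t) {N : ℕ} (hN : Real.exp (2 * t) ≤ (N : ℝ) + 1)
    (M : ℕ) {ψ₀ : ℝ} (hψ : ψ₀ ≤ (digamma (((1 / 4 + (κ : ℝ) / 2 : ℝ)) : ℂ)).re)
    {J : ℕ} (hJ : 0 < J) (φ : ℤ → ℝ) {Φ₀ Φ₁ : ℝ} (hΦ₀ : 0 < Φ₀)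
    (hφlo : ∀ i, 0 ≤ i → i < (J : ℤ) → Φ₀ ≤ φ i) (hφhi : ∀ i, φ i ≤ Φ₁)
    (hφout : ∀ i, i < 0 ∨ (J : ℤ) ≤ i → φ i = 0) (s : ℕ → ℕ)
    (hs : ∀ n ∈ Finset.range (N + 1),
      ((s n : ℤ) : ℝ) * (2 * t / J) ≤ Real.log n ∧ Real.log n ≤ (((s n : ℤ) : ℝ) + 1) * (2 * t / J))
    (wbar : ℕ → ℝ) (hw : ∀ n ∈ Finset.range (N + 1), (Λ n : ℝ) / Real.sqrt n ≤ wbar n) {ρ : ℝ}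
    (hcert : ∀ j ∈ Finset.range J,
      ∑ n ∈ Finset.range (N + 1), wbar n *
        (max (φ ((j : ℤ) - s n - 1)) (φ ((j : ℤ) - s n)) + max (φ ((j : ℤ) + s n)) (φ ((j : ℤ) + s n + 1))) ≤
        ρ * φ (j : ℤ))
    (hB : Real.log π - ψ₀ - ∑ m ∈ Finset.range M, (1 / ((m : ℝ) + (1 / 4 + (κ : ℝ) / 2)) - 2 * t) + ρ ≤
      Real.log q) :
    WeilPositivityOnChar χ t := by
  intro g hg hsupp
  set k := weilConv g (weilReflect g) with hk
  set N2 := weilNorm2Sq g with hN2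
  set x : ℝ := 1 / 4 + (κ : ℝ) / 2 with hx
  have hx0 : 0 < x := by positivity
  have hN20 : 0 ≤ N2 := integral_nonneg fun _ ↦ by positivity
  set A : ℝ := ∫ τ : ℝ, ‖weilMellin g (1 / 2 + τ * I)‖ ^ 2 *
    (digamma ((x : ℂ) + ((τ / 2 : ℝ) : ℂ) * I)).re with hA
  set G : ℝ := ∑ m ∈ Finset.range M, (1 / ((m : ℝ) + x) - 2 * t) with hG
  have hre : (weilQuadraticChar χ g).re =
      -(weilPrimeTermChar χ k).re + (1 / (2 * π) * A + N2 * (Real.log q - Real.log π)) := by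
    rw [weilQuadraticChar_eq_neg_prime_add hq χ hκ hg, Complex.add_re, Complex.neg_re, Complex.ofReal_re]
  -- the prime term through the cell certificate
  have hkc : Continuous k := (hg.weilConv hg.weilReflect).1.continuous
  have hks : tsupport k ⊆ Icc (-(2 * t)) (2 * t) := tsupport_weilConv_weilReflect_subset hg.2 hsupp
  have hPn : ‖weilPrimeTermChar χ k‖ ≤
      ∑ n ∈ Finset.range (N + 1), (Λ n : ℝ) / Real.sqrt n * (2 * ‖k (Real.log n)‖) := by
    rw [weilPrimeTermChar_eq_sum_of_tsupport_subset χ hkc hN hks]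
    refine (norm_sum_le _ _).trans (Finset.sum_le_sum fun n _ ↦ ?_)
    have hΛ : 0 ≤ (Λ n : ℝ) / Real.sqrt n :=
      div_nonneg ArithmeticFunction.vonMangoldt_nonneg (Real.sqrt_nonneg _)
    have hcoef : ‖((Λ n : ℝ) : ℂ) / (Real.sqrt n : ℂ)‖ = (Λ n : ℝ) / Real.sqrt n := by
      rw [← Complex.ofReal_div, Complex.norm_real, Real.norm_of_nonneg hΛ]
    have hχ : ‖χ (n : ZMod q)‖ ≤ 1 := DirichletCharacter.norm_le_one χ _
    have hneg : ‖k (-Real.log n)‖ = ‖k (Real.log n)‖ := by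
      rw [hk, weilConv_weilReflect_neg, Complex.norm_conj]
    rw [norm_mul, hcoef]
    refine mul_le_mul_of_nonneg_left ?_ hΛ
    refine (norm_add_le _ _).trans ?_
    rw [norm_mul, norm_mul, Complex.norm_conj, hneg]
    have hk0 : 0 ≤ ‖k (Real.log n)‖ := norm_nonneg _
    nlinarith [mul_le_mul_of_nonneg_right hχ hk0]
  have hcertR := sum_two_mul_norm_weilConv_le_of_cert hg ht hsupp hJ φ hΦ₀ hφlo hφhi hφout N s hs
    wbar hw hcert
  have hP : (weilPrimeTermChar χ k).re ≤ ρ * N2 :=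
    (Complex.re_le_norm _).trans (hPn.trans hcertR)
  have hArch : ((digamma (x : ℂ)).re + G) * N2 ≤ 1 / (2 * π) * A :=
    arch_lower_bound hg ht hsupp hx0 M
  have hψN : ψ₀ * N2 ≤ (digamma (x : ℂ)).re * N2 := mul_le_mul_of_nonneg_right hψ hN20
  have hBN : (Real.log π - ψ₀ - G + ρ) * N2 ≤ Real.log q * N2 :=
    mul_le_mul_of_nonneg_right hB hN20
  rw [hre]
  nlinarith

end UniformFloor

end Summit.Ventures.WeilGRH

end
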